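import Mathlib
import Summits.Ventures.PercRepro2.Defs
import Summits.Ventures.PercRepro2.Harris
import Summits.Ventures.PercRepro2.Graph
import Summits.Ventures.PercRepro2.Induced
import Summits.Ventures.PercRepro2.VdBKahn
import Summits.Ventures.PercRepro2.NestIID
import Summits.Ventures.PercRepro2.IIDRows
import Summits.Ventures.PercRepro2.CoreForbidIID

/-!
# Every DOWN-TYPE status weight at one vertex keeps the i.i.d. side signs positively correlated
(blind cell PercRepro2, mine-1 g10; MINE-1.md §26, proofs/MINE1-SAMEKERNEL-FRAME.md §6–§8)

Two independent clusters `C, C'` of `s`, both avoiding `T`; a vertex `v` has one of four STATUSES: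
`R = C ∖ C'`, `B = C' ∖ C`, `K = C ∩ C'` (core), `Z` (outside `C ∪ C'`). A status weight
`w = (w_R, w_B, w_K, w_Z)` is DOWN-TYPE when it is non-increasing along `Z ≥ {R, B} ≥ K`:
`w_K ≤ w_R`, `w_K ≤ w_B`, `w_R ≤ w_Z`, `w_B ≤ w_Z` (and `0 ≤ w_K`). The census (mine-1 g10,
`n ≤ 8`, `m ≤ 15`) says these and ONLY these single-vertex weights are admissible in the
complementary model (every "forcing" weight fails: NEG-70/72 and MINE-1.md §26); in the i.i.d.
model with a principal avoided set they are THEOREMS: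

`statusIID w ≥ 0` (`statusIID_nonneg`) — the weight is a nonnegative combination of the five basic
kernels `1` (free, BHK), `1[v ∉ C']` (NEST), `1[v ∉ C]` (NEST), `1 − 1[v∈C]1[v∈C']`
(`coreForbidIID_nonneg`) and `1[v ∉ C]1[v ∉ C']` (BHK at `T ∪ {v}`), with the two cases
`w_K + w_Z ≥ w_R + w_B` / `<` (`statusIID_eq_caseA`, `statusIID_eq_caseB`).
-/

namespace Summit.Ventures.PercRepro2

section StatusIID

variable {V : Type*} {E : Type*} [Fintype E] [DecidableEq E] [Fintype V] [DecidableEq V]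
  {R : Type*} [CommRing R] [LinearOrder R] [IsStrictOrderedRing R]

/-- The status kernel of `v` under two copies: `w_R` on `C ∖ C'`, `w_B` on `C' ∖ C`, `w_K` on the
core, `w_Z` outside the union. -/
noncomputable def statusKernel (ends : E → Sym2 V) (s v : V) (wR wB wK wZ : R)
    (ω ω' : Config E) : R :=
  wR * (connInd ends s v ω * (1 - connInd ends s v ω')) +
    wB * ((1 - connInd ends s v ω) * connInd ends s v ω') +
    wK * (connInd ends s v ω * connInd ends s v ω') +
    wZ * ((1 - connInd ends s v ω) * (1 - connInd ends s v ω'))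

/-- The two-copy same-side sum with both clusters avoiding `T` and the status weight
`(w_R, w_B, w_K, w_Z)` at `v`. -/
noncomputable def statusIID (p : E → R) (ends : E → Sym2 V) (s x y : V) (T : Finset V) (v : V)
    (wR wB wK wZ : R) : R :=
  ∑ ω : Config E, ∑ ω' : Config E,
    weight p ω * weight p ω' * avoidInd ends s T ω * avoidInd ends s T ω' *
      statusKernel ends s v wR wB wK wZ ω ω' *
      ((connInd ends s x ω - connInd ends s x ω') * (connInd ends s y ω - connInd ends s y ω'))

variable (p : E → R) (ends : E → Sym2 V) (s x y : V)

omit [DecidableEq E] [LinearOrder R] [IsStrictOrderedRing R] in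
/-- The avoidance indicator of `insert t X` is the avoidance indicator of `X` times `1[s ↮ t]`
(as in `DeltaMonoNest.avoidInd_insert`; restated here to keep the import closure small). -/
lemma avoidInd_insert_status (X : Finset V) (t : V) (ω : Config E) :
    (avoidInd ends s (insert t X) ω : R) = avoidInd ends s X ω * (1 - connInd ends s t ω) := by
  classical
  simp only [avoidInd, connInd, avoidAll, Set.mem_setOf_eq, Finset.mem_insert, forall_eq_or_imp]
  by_cases hX : ∀ v ∈ X, ¬ Conn ends ω s v
  · by_cases ht : Conn ends ω s t
    · simp [ht]
    · simp [ht]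
  · by_cases ht : Conn ends ω s t
    · simp [hX, ht]
    · simp [hX, ht]

omit [LinearOrder R] [IsStrictOrderedRing R] in
/-- The two-copy nested sum is symmetric in its two avoided sets. -/
lemma nestIID_comm (X Y : Finset V) : nestIID p ends s x y X Y = nestIID p ends s x y Y X := by
  unfold nestIID
  rw [Finset.sum_comm]
  refine Finset.sum_congr rfl fun ω _ => Finset.sum_congr rfl fun ω' _ => ?_
  ring

omit [LinearOrder R] [IsStrictOrderedRing R] in
/-- Case A (`w_K + w_Z ≥ w_R + w_B`): the status sum as a combination of the five basic sums. -/
theorem statusIID_eq_caseA (T : Finset V) (v : V) (wR wB wK wZ : R) :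
    statusIID p ends s x y T v wR wB wK wZ =
      wK * nestIID p ends s x y T T + (wR - wK) * nestIID p ends s x y T (insert v T) +
        (wB - wK) * nestIID p ends s x y (insert v T) T +
        (wK - wR - wB + wZ) * nestIID p ends s x y (insert v T) (insert v T) := by
  unfold statusIID nestIID statusKernel
  simp only [Finset.mul_sum, ← Finset.sum_add_distrib]
  refine Finset.sum_congr rfl fun ω _ => Finset.sum_congr rfl fun ω' _ => ?_
  rw [avoidInd_insert_status (R := R), avoidInd_insert_status (R := R)]
  ring

omit [LinearOrder R] [IsStrictOrderedRing R] in
/-- Case B (`w_K + w_Z ≤ w_R + w_B`): the status sum with the core-forbidden sum instead of the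
doubly-avoided one. -/
theorem statusIID_eq_caseB (T : Finset V) (v : V) (wR wB wK wZ : R) :
    statusIID p ends s x y T v wR wB wK wZ =
      wK * nestIID p ends s x y T T + (wZ - wB) * nestIID p ends s x y T (insert v T) +
        (wZ - wR) * nestIID p ends s x y (insert v T) T +
        (wR + wB - wK - wZ) * coreForbidIID p ends s x y T v := by
  unfold statusIID nestIID coreForbidIID statusKernel
  simp only [Finset.mul_sum, ← Finset.sum_add_distrib]
  refine Finset.sum_congr rfl fun ω _ => Finset.sum_congr rfl fun ω' _ => ?_
  rw [avoidInd_insert_status (R := R), avoidInd_insert_status (R := R)]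
  ring

/-- **Every down-type status weight at one vertex is admissible** (i.i.d. clusters, principal
avoided set): for `0 ≤ w_K ≤ w_R, w_B ≤ w_Z` and `x ≠ y`, `v ∉ {x, y}`, `statusIID ≥ 0`. -/
theorem statusIID_nonneg (hp : IsProbVec p) (T : Finset V) (v : V) {wR wB wK wZ : R}
    (hK : 0 ≤ wK) (hKR : wK ≤ wR) (hKB : wK ≤ wB) (hRZ : wR ≤ wZ) (hBZ : wB ≤ wZ)
    (hxy : x ≠ y) (hxv : x ≠ v) (hyv : y ≠ v) :
    0 ≤ statusIID p ends s x y T v wR wB wK wZ := by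
  have hTT : 0 ≤ nestIID p ends s x y T T :=
    nestIID_nonneg p ends s hp x y (Finset.Subset.refl T)
  have hTv : 0 ≤ nestIID p ends s x y T (insert v T) :=
    nestIID_nonneg p ends s hp x y (Finset.subset_insert v T)
  have hvT : 0 ≤ nestIID p ends s x y (insert v T) T := by
    rw [nestIID_comm]; exact hTv
  have hvv : 0 ≤ nestIID p ends s x y (insert v T) (insert v T) :=
    nestIID_nonneg p ends s hp x y (Finset.Subset.refl _)
  have hcf : 0 ≤ coreForbidIID p ends s x y T v :=
    coreForbidIID_nonneg p ends s hp x y T v hxy hxv hyv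
  rcases le_total (wR + wB) (wK + wZ) with hcase | hcase
  · rw [statusIID_eq_caseA]
    have h1 : 0 ≤ wK - wR - wB + wZ := by linarith
    have h2 : 0 ≤ wR - wK := by linarith
    have h3 : 0 ≤ wB - wK := by linarith
    exact add_nonneg (add_nonneg (add_nonneg (mul_nonneg hK hTT) (mul_nonneg h2 hTv))
      (mul_nonneg h3 hvT)) (mul_nonneg h1 hvv)
  · rw [statusIID_eq_caseB]
    have h1 : 0 ≤ wR + wB - wK - wZ := by linarith
    have h2 : 0 ≤ wZ - wB := by linarith
    have h3 : 0 ≤ wZ - wR := by linarith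
    exact add_nonneg (add_nonneg (add_nonneg (mul_nonneg hK hTT) (mul_nonneg h2 hTv))
      (mul_nonneg h3 hvT)) (mul_nonneg h1 hcf)

end StatusIID

end Summit.Ventures.PercRepro2
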